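import Literature.AnabelianGeometry.SemiGraphs.TreeSystemEscapeMaps
import HarnessLib

/-!
# A tower of trees whose fixed loci escape along an end: compatible fixed systems need more than tree combinatorics

Mochizuki, *Semi-graphs of anabelioids*, Publ. RIMS **42** (2006), §3, Theorem 3.7 (iii), manuscript
pp. 40–41 [cite: MochizukiSemiAnbd2006, Thm 3.7(iii) pp.40-41].  The printed proof derives, for a compact
subgroup `H ⊆ π₁^temp(𝒢)` acting on the trees `𝒢_{∞,j}` of a cofinal system of finite étale coverings,
that "we may assume that there exists a compatible system of vertices of `𝒢_{∞,j}`, for `j ∈ J`, each of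
which is fixed by `H`" (p. 41) — using, at exactly this point, that "the semi-graphs `𝔾_j` are all finite".
For an infinite countable `𝒢` the existence of such a COMPATIBLE fixed system is the residual of the cell's
Thm. 3.7 (iii) work (gap G-t6g3-2b, the clause `hfix` of `compactInVerticial_of_fixedSystems`; desk
countermodel candidate `𝒢_θ` on record — escape of a compact subgroup along an end).

This PROOF-ONLY file assembles the kernel TEST OBJECT for that residual from `TreeSystemEscapeTrees.lean`
and `TreeSystemEscapeMaps.lean`: the tower of trees `T j := Y_{j+1}` over the base ray `B := Y_0`
(`proj j :=` the fold to `0`), acted on through the swaps, with functorial equivariant transition folds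
over the base, surjective on vertices with finite fibres — such that every level HAS fixed vertices (the
tail `n ≥ j+1`), the base images of the fixed loci are exactly the receding tails `[j+1, ∞)`
(`escapeTower_baseImage_fixed_iff`), every base vertex is eventually left (`escapeTower_baseImages_escape`
— «horizontal escape along the end of the ray»), and NO compatible system of fixed vertices exists
(`escapeTower_no_compatible_fixed_system`); everything in one statement:
`exists_treeSystem_horizontalEscape`.  Consequently no lemma phrased over the generic tree-system binders
alone (trees, a group action at each level, transition morphisms over a base — even with finite fibres and
an action through an involution) produces a compatible fixed system; a proof of `hfix` for a given `𝒢`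
must consume structure of its canonical tower.  The folds are not locally surjective at the arm vertices (a
finite étale covering induces locally surjective maps): the example isolates the combinatorial phenomenon
only.

Nothing in this file takes a side on [IUTchIII] Cor. 3.12; it asserts nothing about `π₁^temp`.
-/

namespace Literature.AnabelianGeometry.SemiGraphs

open CategoryTheory

universe u

namespace SemiGraph

/-! ### The escape tower: levels `Y_{j+1}`, base `Y_0` -/

/-- Every level has a fixed vertex: the tail point `(false, j+1)`. [cite: MochizukiSemiAnbd2006, Thm 3.7(iii) p.41] -/
theorem escapeTower_exists_fixed (j : ℕ) :
    ∃ p : (escapeTree (j + 1)).Vertex, ∀ γ : Multiplicative ℤ, (escapeAct (j + 1) γ).hom.vertexMap p = p :=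
  ⟨⟨(false, j + 1), Or.inr rfl⟩, (escapeAct_fixed_iff _ _).mpr le_rfl⟩

/-- The base image of a fixed vertex of level `j` lies in the tail `[j+1, ∞)` of the base ray, and every
base vertex of that tail is such an image. [cite: MochizukiSemiAnbd2006, Thm 3.7(iii) p.41] -/
theorem escapeTower_baseImage_fixed_iff (j : ℕ) (v : (escapeTree 0).Vertex) :
    (∃ p : (escapeTree (j + 1)).Vertex, (∀ γ : Multiplicative ℤ, (escapeAct (j + 1) γ).hom.vertexMap p = p) ∧
      (escapeFold (Nat.zero_le (j + 1))).vertexMap p = v) ↔ j + 1 ≤ v.1.2 := by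
  constructor
  · rintro ⟨p, hp, rfl⟩
    exact (escapeAct_fixed_iff _ _).mp hp
  · intro hv
    refine ⟨⟨(false, v.1.2), Or.inr rfl⟩, (escapeAct_fixed_iff _ _).mpr hv, EscIdx.ext ?_⟩
    obtain ⟨⟨s, n⟩, hs⟩ := v
    rcases hs with hs | hs
    · exact absurd hs (Nat.not_lt_zero _)
    · simp only at hs
      subst hs
      simp

/-- **Horizontal escape**: every base vertex eventually leaves the base images of the fixed loci.
[cite: MochizukiSemiAnbd2006, Thm 3.7(iii) p.41] -/
theorem escapeTower_baseImages_escape (v : (escapeTree 0).Vertex) :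
    ∃ j : ℕ, ∀ p : (escapeTree (j + 1)).Vertex,
      (∀ γ : Multiplicative ℤ, (escapeAct (j + 1) γ).hom.vertexMap p = p) →
        (escapeFold (Nat.zero_le (j + 1))).vertexMap p ≠ v := by
  refine ⟨v.1.2, fun p hp hpv => ?_⟩
  have h1 : v.1.2 + 1 ≤ v.1.2 := (escapeTower_baseImage_fixed_iff v.1.2 v).mp ⟨p, hp, hpv⟩
  omega

/-- **No compatible fixed system**: there is no system of vertices `x j` of the levels `Y_{j+1}`,
compatible under the folds, each fixed by the action. [cite: MochizukiSemiAnbd2006, Thm 3.7(iii) p.41] -/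
theorem escapeTower_no_compatible_fixed_system :
    ¬ ∃ x : ∀ j : ℕ, (escapeTree (j + 1)).Vertex,
      (∀ ⦃i j : ℕ⦄ (h : i ≤ j), (escapeFold (Nat.succ_le_succ h)).vertexMap (x j) = x i) ∧
      ∀ (j : ℕ) (γ : Multiplicative ℤ), (escapeAct (j + 1) γ).hom.vertexMap (x j) = x j := by
  rintro ⟨x, hc, hf⟩
  set n := (x 0).1.2 with hn
  have h1 : n + 1 ≤ (x n).1.2 := (escapeAct_fixed_iff _ _).mp (hf n)
  have h2 : (x n).1.2 = n := by
    have := congrArg (fun p : EscIdx 1 => p.1.2) (hc (Nat.zero_le n))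
    exact this
  omega

/-- **The escape tower, assembled** ([SemiAnbd] Thm. 3.7 (iii), test object for the residual `hfix` at
infinite `𝒢`): trees `T j`, actions `ρ j` of one group, functorial equivariant transition morphisms over a
base semi-graph `B` on which the group acts trivially, surjective on vertices with finite fibres, a fixed
vertex at every level, base images of the fixed loci escaping every base vertex — and no compatible fixed
vertex system.  So the generic tree-system layer alone cannot produce compatible fixed systems.
[cite: MochizukiSemiAnbd2006, Thm 3.7(iii) pp.40-41] -/
theorem exists_treeSystem_horizontalEscape :
    ∃ (T : ℕ → SemiGraph.{0}) (ρ : ∀ j, Multiplicative ℤ →* Aut (T j))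
      (f : ∀ ⦃i j : ℕ⦄, i ≤ j → (T j ⟶ T i)) (B : SemiGraph.{0}) (proj : ∀ j, T j ⟶ B),
      (∀ j, (T j).IsTree) ∧ (∀ j, (T j).IsGraph) ∧ B.IsTree ∧
      (∀ j, f (le_refl j) = 𝟙 (T j)) ∧
      (∀ ⦃i j k : ℕ⦄ (hij : i ≤ j) (hjk : j ≤ k), f hjk ≫ f hij = f (hij.trans hjk)) ∧
      (∀ ⦃i j : ℕ⦄ (h : i ≤ j) (γ : Multiplicative ℤ), (ρ j γ).hom ≫ f h = f h ≫ (ρ i γ).hom) ∧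
      (∀ ⦃i j : ℕ⦄ (h : i ≤ j), f h ≫ proj i = proj j) ∧
      (∀ (j : ℕ) (γ : Multiplicative ℤ), (ρ j γ).hom ≫ proj j = proj j) ∧
      (∀ ⦃i j : ℕ⦄ (h : i ≤ j), Function.Surjective (f h).vertexMap) ∧
      (∀ (j : ℕ) (v : B.Vertex), Set.Finite ((proj j).vertexMap ⁻¹' {v})) ∧
      (∀ j, ∃ p : (T j).Vertex, ∀ γ, (ρ j γ).hom.vertexMap p = p) ∧
      (∀ v : B.Vertex, ∃ j, ∀ p : (T j).Vertex, (∀ γ, (ρ j γ).hom.vertexMap p = p) →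
        (proj j).vertexMap p ≠ v) ∧
      ¬ ∃ x : ∀ j, (T j).Vertex, (∀ ⦃i j : ℕ⦄ (h : i ≤ j), (f h).vertexMap (x j) = x i) ∧
        ∀ j γ, (ρ j γ).hom.vertexMap (x j) = x j := by
  refine ⟨fun j => escapeTree (j + 1), fun j => escapeAct (j + 1),
    fun i j h => escapeFold (Nat.succ_le_succ h), escapeTree 0, fun j => escapeFold (Nat.zero_le (j + 1)),
    fun j => escapeTree_isTree (j + 1), fun j => escapeTree_isGraph (j + 1), escapeTree_isTree 0,
    fun j => escapeFold_refl (j + 1), fun i j k hij hjk => escapeFold_comp _ _,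
    fun i j h γ => escapeAct_comp_escapeFold _ γ, fun i j h => escapeFold_comp _ _, fun j γ => ?_,
    fun i j h => escapeFold_vertexMap_surjective _, fun j v => escapeFold_fibre_finite _ v,
    escapeTower_exists_fixed, escapeTower_baseImages_escape, escapeTower_no_compatible_fixed_system⟩
  rw [escapeAct_comp_escapeFold, escapeAct_zero_hom]
  exact Category.comp_id _


end SemiGraph

end Literature.AnabelianGeometry.SemiGraphs
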